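import Summits.AtomisticToContinuum.Crystallization.Theorems.PalmUnimodularRigidityShellsToBarlowChartTransportGlobalG
import Summits.AtomisticToContinuum.Crystallization.Theorems.PalmUnimodularRigidityShellsToBarlowChartCubicGrowth

/-!
# Line `develop-the-model-growth-descent` (crux `ShellsToBarlowChart`, stmt-AtomisticToContinuum-9227): `stub_transportSystem`

The geometric half of the line: a nonempty good-shell configuration with local charts carries a
transport system (`TransportSystem`).  Everything was proved in the `Transport*` files modulo
connectivity of the window graph (`transportSystem_of_connected`); connectivity is the greedy
walk `exists_walk` of the growth file.  [folklore]
-/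

noncomputable section

namespace Summit.AtomisticToContinuum.Crystallization.Theorems.PalmUnimodularRigidityShellsToBarlowChart

open Literature.Geometry.DiscreteGeometry Literature.MathematicalPhysics.StatisticalMechanics

/-- **The window graph of a good-shell configuration is connected** (greedy walks). [folklore] -/
theorem windowGraph_connected {S : Set (EuclideanSpace ℝ (Fin 3))} (hS : GoodShells S) :
    ∀ x ∈ S, ∀ y ∈ S, Nonempty ((windowGraph S).Walk x y) := by
  intro x hx y hy
  have hm : dist x y ≤ 3 / 2 + ((⌈3 * dist x y⌉₊ : ℕ) : ℝ) / 3 := by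
    have h1 : 3 * dist x y ≤ ((⌈3 * dist x y⌉₊ : ℕ) : ℝ) := Nat.le_ceil _
    linarith [dist_nonneg (x := x) (y := y)]
  obtain ⟨w, -⟩ := exists_walk hS hy ⌈3 * dist x y⌉₊ x hx hm
  exact ⟨w⟩

/-- **stub 0 of the line — the transport system of a good-shell configuration.**  Integer charts
at every site (`isZChart_of_localChart`), frames transported along `I, J` (in-layer) and `V, V⁻¹`
(across layers) with the orientation carried by the caps, coherence of the development
(`layers`), STAR/LINK read off the label table of each site (`star_at`), reachability along greedy
walks. [folklore] -/
theorem stub_transportSystem :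
    ∀ S : Set (EuclideanSpace ℝ (Fin 3)), S.Nonempty → GoodShells S → (∀ x ∈ S, LocalChart S x) → TransportSystem S :=
  fun _ hne hS hL => transportSystem_of_connected hne hL (windowGraph_connected hS)

end Summit.AtomisticToContinuum.Crystallization.Theorems.PalmUnimodularRigidityShellsToBarlowChart

end
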